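/-
Copyright (c) 2026 the pub-hodgecm-mathlib formalisation cell (harness21).  Prover seat hodgecm-mathlib-K2E3-p23 (g6), HCML Track B «K2-LIT» ∕ h413
(`stmt-HodgeConjecture-24833`), line `K2_E3_EllipticInputs`, leaf (S-C′-irr) `sig_K2E3GL3TwoBlockInducedIrreducible`, line «SC′-IRR-lev» (lead K2E3-p24 (g2),
dealer K2E3-plan (g4), architect K2E3-p25), brick DEG (hand BY NAME, lead's letters 2026-09-04T10:27:03Z).  2026-09-04.
-/
import Summits.HodgeConjecture.HodgeConjecture.Theorems.K2E3GL3DegenerateLevelOne          -- ★ LEV-3 (K2E3-p17 g8): `apply_eq_self_of_mem_upperUnitriangular_of_degenerate` (`θ′(u) = ψ(u₁₂)`)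
import Summits.HodgeConjecture.HodgeConjecture.Theorems.K2E3GL3DegenerateLevelOneMirror    -- ★ LEV-3 mirror (K2E3-p17 g8): `apply_eq_self_of_mem_upperUnitriangular_of_degenerate'` (`θ₃(u) = ψ(u₀₁)`)
import Summits.HodgeConjecture.HodgeConjecture.Theorems.K2E3GL3MaximalParabolicRelabel      -- ★ K0 (K2E3-p24 g2): `monotone_twoOne`, `monotone_oneTwo` (the labellings `c₀ = ![0,0,1]`, `c₁ = ![0,1,1]`)
import Literature.NumberTheory.Automorphic.GLnCongruenceSubgroups                          -- ★ `mem_unipotentRadicalGL_iff_apply` (entrywise membership in `U_c`)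
import HarnessLib

/-!
# Line «SC′-IRR-lev», brick DEG: a NON-GENERIC irreducible smooth representation of `GL₃(F)` has BOTH maximal Jacquet modules non-zero

Cell `pub/hodgecm-mathlib` (D-0151), Track B «K2-LIT», crux H413 = `stmt-HodgeConjecture-24833`, route of record `HCCMUnconditional`.  Lane
`--supports stmt-HodgeConjecture-24833 --as helper`; THEOREMS ONLY (no `def`, no `instance`, no `notation`, no named-fact hypothesis, no `sorry`); count-neutral.

THE STATEMENT (head **`false_of_degenerate_of_subsingleton_coinvariants`**, the lead's bytes): for `ω` irreducible smooth on `GL₃(F)`, `ψ` a continuous non-trivial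
additive character with `ω` NOT `ψ`-generic, it is impossible that `r_{c₀}(ω) = 0` or `r_{c₁}(ω) = 0`, where `c₀ = ![0,0,1]` (`P₍₂,₁₎`) and `c₁ = ![0,1,1]` (`P₍₁,₂₎`) are
the two maximal standard parabolics and `r_c(ω) = (restrictUnipotentGL F c ω).Coinvariants` is the ★ `jacquetGL` currency.  (Bernstein–Zelevinsky: a degenerate
irreducible representation all of whose proper Jacquet modules but one vanish would be cuspidal-like yet one-dimensional — here without the derivative formalism.)

PROOF (the lead's route, every input ★).
* §1 (any `n`, any `R`) **`coinvariantsMk_whittakerTwist_eq_zero_of_not_isGeneric`**: `¬ IsGeneric π ψ` means `Hom_U(π, ψ) = 0`, and ★ `whittakerFunctionalsEquivDual`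
  identifies `Hom_U(π, ψ)` with the dual of `J_ψ(π)`; a vector space with zero dual is zero (`Module.forall_dual_apply_eq_zero_iff`), so `J_ψ(π) = 0`: `hnd`.
* §2 (`GL₃`, any monotone two-block labelling `c`) if `r_c(ω) = 0` then every `v` lies in `V(U_c) = ⟨ω(n) w − w⟩`; for a character `θ` of `U₃` TRIVIAL ON `U_c` these
  generators lie in `V(U₃, θ)` (★ `sub_smul_mem_ker_charTwist`), so `ω_{U₃,θ} = 0`: **`coinvariantsMk_charTwist_eq_zero_of_subsingleton`**; and if `U₃` acts trivially
  then `V(U_c) = 0` (**`ker_restrictUnipotentGL_eq_bot_of_forall_apply_eq_self`**), contradicting `r_c(ω) = 0` on a non-zero space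
  (**`false_of_subsingleton_coinvariants_of_forall_apply_eq_self`**).
* §3 the head (labellings monotone by ★ K0 `monotone_twoOne`∕`monotone_oneTwo`): for `c₁`, `θ′(u) = ψ(u₁₂)` (★ `exists_character_upperUnitriangular ψ 0 1`) is trivial on `U_{c₁}` (entry `(1,2)` vanishes there,
  ★ `mem_unipotentRadicalGL_iff_apply`), so §2 gives `hdeg′` and ★ LEV-3 `apply_eq_self_of_mem_upperUnitriangular_of_degenerate` makes `U₃` act trivially; for `c₀`,
  `θ₃(u) = ψ(u₀₁)` (★ `… ψ 1 0`) is trivial on `U_{c₀}` and ★ LEV-3 mirror `apply_eq_self_of_mem_upperUnitriangular_of_degenerate'` does the same; §2 closes.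
No admissibility, no `ψ`-conductor, no Haar measure is used.

HONEST LABEL: HC_CM is proved only modulo the 7 printed citations (2 remaining named inputs: hLiu418 = stmt-HodgeConjecture-24832, h413 = stmt-HodgeConjecture-24833) until
rung 0 closes; count-neutral helper (consumed BY NAME by the line's ASM `K2E3GL3TwoBlockInducedIrreducible`, lead K2E3-p24 (g2)); closes no socket.

## References
* [BernsteinZelevinskyASENS1977] I. N. Bernstein, A. V. Zelevinsky, *Induced representations of reductive p-adic groups I*, Ann. Sci. ÉNS 10 (1977), §1.8 (b), Thm. 4.7.
* [Zelevinsky1980] A. V. Zelevinsky, *Induced representations of reductive p-adic groups II*, Ann. Sci. ÉNS 13 (1980), 4.3.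
* [Bump1997] D. Bump, *Automorphic Forms and Representations*, CUP (1997), §4.4, Prop. 4.4.4 (Whittaker functionals = dual of `J_ψ`).
-/

set_option autoImplicit false
-- the mandated namespace repeats `HodgeConjecture.HodgeConjecture`, as in every `Theorems/*.lean` of this sub-problem
set_option linter.dupNamespace false

noncomputable section

open Representation Matrix Literature.NumberTheory.Automorphic Literature.NumberTheory.GaloisRepresentations.IsNonarchimedeanLocalField
open scoped MatrixGroups
open Summit.HodgeConjecture.HodgeConjecture.Cruxes.H413.K2E3GL3UnipotentCharacters (exists_character_upperUnitriangular)
open Summit.HodgeConjecture.HodgeConjecture.Cruxes.H413.K2E3GL3DegenerateLevelOne (apply_eq_self_of_mem_upperUnitriangular_of_degenerate)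
open Summit.HodgeConjecture.HodgeConjecture.Cruxes.H413.K2E3GL3DegenerateLevelOneMirror (apply_eq_self_of_mem_upperUnitriangular_of_degenerate')
open Summit.HodgeConjecture.HodgeConjecture.Cruxes.H413.K2E3GL3MaximalParabolicRelabel (monotone_twoOne monotone_oneTwo)

namespace Summit.HodgeConjecture.HodgeConjecture.Cruxes.H413.K2E3GL3DegenerateJacquetVanishing

/-! ## §1 Non-generic ⇒ the twisted Jacquet module `J_ψ(π)` vanishes (any `n`, any commutative ring `R`) -/

section Whittaker

variable {R : Type*} [CommRing R] {n : ℕ} {V : Type*} [AddCommGroup V] [Module ℂ V]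

/-- **`¬ IsGeneric π ψ ⇒ J_ψ(π) = 0`**: if `π` admits no non-zero `ψ`-Whittaker functional, every class in the twisted Jacquet module `J_ψ(π) = V ⧸ V(U_n, ψ_U)` is
zero — `Hom_{U_n}(π, ψ_U) ≃ J_ψ(π)^*` (★ `whittakerFunctionalsEquivDual`) and a `ℂ`-vector space with zero dual is zero.
[cite: Bump1997, Prop. 4.4.4 (proof) (PDF p. 462)] [cite: BernsteinZelevinskyASENS1977, §1.8 (b)] -/
theorem coinvariantsMk_whittakerTwist_eq_zero_of_not_isGeneric (π : Representation ℂ (GL (Fin n) R) V) (ψ : AddChar R Circle)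
    (h : ¬ IsGeneric π ψ) (v : V) : Coinvariants.mk (whittakerTwist π ψ) v = 0 := by
  have hbot : whittakerFunctionals π ψ = ⊥ := by
    by_contra h'
    exact h h'
  refine (Module.forall_dual_apply_eq_zero_iff ℂ _).1 fun φ => ?_
  have hΛ : (((whittakerFunctionalsEquivDual π ψ).symm φ : ↥(whittakerFunctionals π ψ)) : Module.Dual ℂ V) = 0 := by
    exact (Submodule.mem_bot ℂ).1 (hbot.le ((whittakerFunctionalsEquivDual π ψ).symm φ).2)
  rw [← whittakerFunctionalsEquivDual_symm_apply π ψ φ v, hΛ, LinearMap.zero_apply]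

end Whittaker

/-! ## §2 `GL₃(F)`: vanishing of a maximal Jacquet module versus characters of `U₃` trivial on its radical -/

section GL3

variable {F : Type*} [Field F] [ValuativeRel F] [TopologicalSpace F] [IsNonarchimedeanLocalField F]
  {V : Type*} [AddCommGroup V] [Module ℂ V] (ω : Representation ℂ (GL (Fin 3) F) V)

omit [ValuativeRel F] [TopologicalSpace F] [IsNonarchimedeanLocalField F] in
/-- **`V(U_c) ≤ V(U₃, θ)` for `θ` trivial on `U_c`** (`c` a monotone labelling, so `U_c ≤ U₃`): the generators `ω(n) w − w`, `n ∈ U_c`, of the kernel of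
`V → r_c(V)` are generators `ω(n) w − θ(n) w` of `V(U₃, θ)` (★ `sub_smul_mem_ker_charTwist`). [cite: BernsteinZelevinskyASENS1977, §1.8 (b)] -/
theorem ker_restrictUnipotentGL_le_ker_charTwist {c : Fin 3 → Fin 2} (hc : Monotone c) (θ : ↥(upperUnitriangular (Fin 3) F) →* ℂˣ)
    (hθ : ∀ u : ↥(upperUnitriangular (Fin 3) F), (u : GL (Fin 3) F) ∈ unipotentRadicalGL F c → θ u = 1) :
    Coinvariants.ker (restrictUnipotentGL F c ω) ≤ Coinvariants.ker (ω.charTwist (upperUnitriangular (Fin 3) F) θ) := by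
  intro x hx
  refine Submodule.span_induction (fun y hy => ?_) (Submodule.zero_mem _) (fun a b _ _ ha hb => Submodule.add_mem _ ha hb)
    (fun r a _ ha => Submodule.smul_mem _ r ha) hx
  obtain ⟨⟨u, v⟩, rfl⟩ := hy
  have huU : ((u : ↥(standardParabolicGL F c)) : GL (Fin 3) F) ∈ unipotentRadicalGL F c := ⟨(u : ↥(standardParabolicGL F c)), u.2, rfl⟩
  have hu3 : ((u : ↥(standardParabolicGL F c)) : GL (Fin 3) F) ∈ upperUnitriangular (Fin 3) F := unipotentRadicalGL_le_upperUnitriangular c hc huU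
  have key := sub_smul_mem_ker_charTwist ω (upperUnitriangular (Fin 3) F) θ ⟨_, hu3⟩ v
  rw [hθ ⟨_, hu3⟩ huU, one_smul] at key
  exact key

omit [ValuativeRel F] [TopologicalSpace F] [IsNonarchimedeanLocalField F] in
/-- **`r_c(ω) = 0 ⇒ ω_{U₃,θ} = 0` for every character `θ` of `U₃` trivial on `U_c`**: every `v` lies in `V(U_c) ≤ V(U₃, θ)`.
[cite: BernsteinZelevinskyASENS1977, §1.8 (b)] -/
theorem coinvariantsMk_charTwist_eq_zero_of_subsingleton {c : Fin 3 → Fin 2} (hc : Monotone c) (θ : ↥(upperUnitriangular (Fin 3) F) →* ℂˣ)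
    (hθ : ∀ u : ↥(upperUnitriangular (Fin 3) F), (u : GL (Fin 3) F) ∈ unipotentRadicalGL F c → θ u = 1)
    (hsub : Subsingleton (restrictUnipotentGL F c ω).Coinvariants) (v : V) :
    Coinvariants.mk (ω.charTwist (upperUnitriangular (Fin 3) F) θ) v = 0 := by
  have hmem : v ∈ Coinvariants.ker (restrictUnipotentGL F c ω) := (Coinvariants.mk_eq_zero _).1 (Subsingleton.elim _ _)
  exact (Coinvariants.mk_eq_zero _).2 (ker_restrictUnipotentGL_le_ker_charTwist ω hc θ hθ hmem)

omit [ValuativeRel F] [TopologicalSpace F] [IsNonarchimedeanLocalField F] in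
/-- **If `U₃` acts trivially then `V(U_c) = 0`** (`c` monotone: `U_c ≤ U₃`, so every generator `ω(n) w − w` vanishes). [cite: BernsteinZelevinskyASENS1977, §1.8 (b)] -/
theorem ker_restrictUnipotentGL_eq_bot_of_forall_apply_eq_self {c : Fin 3 → Fin 2} (hc : Monotone c)
    (hU : ∀ u ∈ upperUnitriangular (Fin 3) F, ∀ v : V, ω u v = v) :
    Coinvariants.ker (restrictUnipotentGL F c ω) = ⊥ := by
  refine (Submodule.eq_bot_iff _).2 fun x hx => ?_
  refine Submodule.span_induction (fun y hy => ?_) rfl (fun a b _ _ ha hb => by rw [ha, hb, add_zero]) (fun r a _ ha => by rw [ha, smul_zero]) hx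
  obtain ⟨⟨u, v⟩, rfl⟩ := hy
  have huU : ((u : ↥(standardParabolicGL F c)) : GL (Fin 3) F) ∈ unipotentRadicalGL F c := ⟨(u : ↥(standardParabolicGL F c)), u.2, rfl⟩
  have hu3 : ((u : ↥(standardParabolicGL F c)) : GL (Fin 3) F) ∈ upperUnitriangular (Fin 3) F := unipotentRadicalGL_le_upperUnitriangular c hc huU
  show ω ((u : ↥(standardParabolicGL F c)) : GL (Fin 3) F) v - v = 0
  rw [hU _ hu3, sub_self]

omit [ValuativeRel F] [TopologicalSpace F] [IsNonarchimedeanLocalField F] in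
/-- **`r_c(ω) = 0` is impossible on a non-zero space on which `U₃` acts trivially** (`V(U_c) = 0`, so `r_c(V) = V ≠ 0`).
[cite: BernsteinZelevinskyASENS1977, §1.8 (b)] -/
theorem false_of_subsingleton_coinvariants_of_forall_apply_eq_self [Nontrivial V] {c : Fin 3 → Fin 2} (hc : Monotone c)
    (hU : ∀ u ∈ upperUnitriangular (Fin 3) F, ∀ v : V, ω u v = v) (hsub : Subsingleton (restrictUnipotentGL F c ω).Coinvariants) : False := by
  obtain ⟨v, hv⟩ := exists_ne (0 : V)
  have hmem : v ∈ Coinvariants.ker (restrictUnipotentGL F c ω) := (Coinvariants.mk_eq_zero _).1 (Subsingleton.elim _ _)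
  rw [ker_restrictUnipotentGL_eq_bot_of_forall_apply_eq_self ω hc hU, Submodule.mem_bot] at hmem
  exact hv hmem

omit [ValuativeRel F] [TopologicalSpace F] [IsNonarchimedeanLocalField F] in
/-- On `U_{c₀}` (`c₀ = ![0,0,1]`, radical of `P₍₂,₁₎`: positions `(0,2)`, `(1,2)`) the entry `(0,1)` vanishes. [folklore] -/
theorem apply_zero_one_eq_zero_of_mem_unipotentRadicalGL_twoOne {u : GL (Fin 3) F} (hu : u ∈ unipotentRadicalGL F (![0, 0, 1] : Fin 3 → Fin 2)) :
    (u : Matrix (Fin 3) (Fin 3) F) 0 1 = 0 := by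
  rw [(mem_unipotentRadicalGL_iff_apply u).1 hu 0 1 (by decide), Matrix.one_apply_ne (by decide)]

omit [ValuativeRel F] [TopologicalSpace F] [IsNonarchimedeanLocalField F] in
/-- On `U_{c₁}` (`c₁ = ![0,1,1]`, radical of `P₍₁,₂₎`: positions `(0,1)`, `(0,2)`) the entry `(1,2)` vanishes. [folklore] -/
theorem apply_one_two_eq_zero_of_mem_unipotentRadicalGL_oneTwo {u : GL (Fin 3) F} (hu : u ∈ unipotentRadicalGL F (![0, 1, 1] : Fin 3 → Fin 2)) :
    (u : Matrix (Fin 3) (Fin 3) F) 1 2 = 0 := by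
  rw [(mem_unipotentRadicalGL_iff_apply u).1 hu 1 2 (by decide), Matrix.one_apply_ne (by decide)]

/-! ## §3 The head -/

/-- **DEG — A NON-GENERIC IRREDUCIBLE SMOOTH REPRESENTATION OF `GL₃(F)` HAS `r_{c₀}(ω) ≠ 0` AND `r_{c₁}(ω) ≠ 0`.**  For `ω` irreducible smooth, `ψ` continuous
non-trivial, `ω` not `ψ`-generic (`Hom_{U₃}(ω, ψ_nd) = 0`): neither maximal Jacquet module `r_{c₀}(ω)` (`c₀ = ![0,0,1]`, `P₍₂,₁₎`) nor `r_{c₁}(ω)` (`c₁ = ![0,1,1]`,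
`P₍₁,₂₎`) vanishes.  Indeed `r_{c₁}(ω) = 0` forces `ω_{U₃,θ′} = 0` for `θ′(u) = ψ(u₁₂)` (trivial on `U_{c₁}`), and with `ω_{U₃,ψ_nd} = 0` ★ LEV-3 makes `U₃` act trivially,
whence `V(U_{c₁}) = 0` and `r_{c₁}(ω) = V ≠ 0`; symmetrically for `c₀` with `θ₃(u) = ψ(u₀₁)` and ★ LEV-3 mirror.
[cite: BernsteinZelevinskyASENS1977, Thm. 4.7] [cite: Zelevinsky1980, 4.3] [cite: Bump1997, Prop. 4.4.4 (proof) (PDF p. 462)] -/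
theorem false_of_degenerate_of_subsingleton_coinvariants [ω.IsIrreducible] (hω : ω.IsSmooth) {ψ : AddChar F Circle} (hψ : ψ.IsContinuousNontrivial)
    (hdg : ¬ IsGeneric ω ψ)
    (h : Subsingleton (restrictUnipotentGL F (![0, 0, 1] : Fin 3 → Fin 2) ω).Coinvariants ∨
      Subsingleton (restrictUnipotentGL F (![0, 1, 1] : Fin 3 → Fin 2) ω).Coinvariants) : False := by
  haveI : Nontrivial V := IsIrreducible.nontrivial ω
  have hnd : ∀ v, Coinvariants.mk (whittakerTwist ω ψ) v = 0 := coinvariantsMk_whittakerTwist_eq_zero_of_not_isGeneric ω ψ hdg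
  rcases h with h₀ | h₁
  · -- `r_{c₀}(ω) = 0`: the character `θ₃(u) = ψ(u₀₁)` of `U₃` is trivial on `U_{c₀}`
    obtain ⟨θ₃, hθ₃'⟩ := exists_character_upperUnitriangular ψ (1 : F) 0
    have hθ₃ : ∀ u : ↥(upperUnitriangular (Fin 3) F), ((θ₃ u : ℂˣ) : ℂ) = ψ (((u : GL (Fin 3) F) : Matrix (Fin 3) (Fin 3) F) 0 1) := fun u => by
      rw [hθ₃' u, one_mul, zero_mul, add_zero]
    have hθ₃1 : ∀ u : ↥(upperUnitriangular (Fin 3) F), (u : GL (Fin 3) F) ∈ unipotentRadicalGL F (![0, 0, 1] : Fin 3 → Fin 2) → θ₃ u = 1 :=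
      fun u hu => Units.ext (by rw [hθ₃ u, apply_zero_one_eq_zero_of_mem_unipotentRadicalGL_twoOne hu, AddChar.map_zero_eq_one, Circle.coe_one, Units.val_one])
    have hdeg : ∀ v, Coinvariants.mk (ω.charTwist (upperUnitriangular (Fin 3) F) θ₃) v = 0 :=
      coinvariantsMk_charTwist_eq_zero_of_subsingleton ω monotone_twoOne θ₃ hθ₃1 h₀
    exact false_of_subsingleton_coinvariants_of_forall_apply_eq_self ω monotone_twoOne
      (fun u hu v => apply_eq_self_of_mem_upperUnitriangular_of_degenerate' ω hψ hω hnd θ₃ hθ₃ hdeg hu v) h₀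
  · -- `r_{c₁}(ω) = 0`: the character `θ′(u) = ψ(u₁₂)` of `U₃` is trivial on `U_{c₁}`
    obtain ⟨θ', hθ''⟩ := exists_character_upperUnitriangular ψ (0 : F) 1
    have hθ' : ∀ u : ↥(upperUnitriangular (Fin 3) F), ((θ' u : ℂˣ) : ℂ) = ψ (((u : GL (Fin 3) F) : Matrix (Fin 3) (Fin 3) F) 1 2) := fun u => by
      rw [hθ'' u, zero_mul, one_mul, zero_add]
    have hθ'1 : ∀ u : ↥(upperUnitriangular (Fin 3) F), (u : GL (Fin 3) F) ∈ unipotentRadicalGL F (![0, 1, 1] : Fin 3 → Fin 2) → θ' u = 1 :=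
      fun u hu => Units.ext (by rw [hθ' u, apply_one_two_eq_zero_of_mem_unipotentRadicalGL_oneTwo hu, AddChar.map_zero_eq_one, Circle.coe_one, Units.val_one])
    have hdeg : ∀ v, Coinvariants.mk (ω.charTwist (upperUnitriangular (Fin 3) F) θ') v = 0 :=
      coinvariantsMk_charTwist_eq_zero_of_subsingleton ω monotone_oneTwo θ' hθ'1 h₁
    exact false_of_subsingleton_coinvariants_of_forall_apply_eq_self ω monotone_oneTwo
      (fun u hu v => apply_eq_self_of_mem_upperUnitriangular_of_degenerate ω hψ hω hnd θ' hθ' hdeg hu v) h₁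

end GL3

end Summit.HodgeConjecture.HodgeConjecture.Cruxes.H413.K2E3GL3DegenerateJacquetVanishing

end
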